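import Summits.HubbardSuperconductivity.HubbardSuperconductivity.Theorems.CooperPairDMottWalkPlaquetteGramCert

/-!
# Route `CooperPairDMottWalk`, crux `CooperPairDMott`: algebra for the plaquette grand-canonical window

Helper file for the stub `stub_plaquetteGCWindow` of the line `Cruxes/CooperPairDMott/Lines/birth.lean`
(item stmt-HubbardSuperconductivity-1177): the certified grand-canonical stability window of the
4-electron singlet of the `2 × 2` Hubbard plaquette. Four generic ingredients, all elementary:

* `formBound_transpose`: a lower bound of the real sector form `hopR Ka Kb + U · dblR d` transfers
  to the mirrored sector (`(a, b) ↦ (b, a)`, arrays transposed);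
* `formBound_chord24`: the sector form is affine in `U`, so bounds at `U = 2` and `U = 4` give the
  chord bound on `[2, 4]`;
* `bMatR`, `form_lowerBound_rankOne_of_ddCheckP`: the Gram / diagonal-dominance certificate of
  `…PlaquetteGramCert` for the DEFLATED form `N·(hop + U·dbl) + P·(u·x)² − m·‖x‖²` (a rank-one
  term along an integer array `u`), giving `m‖x‖² ≤ N·form(x) + P (u·x)²`;
* `deflate_bound`: if a Hermitian `h` has an eigenvector `χ ≠ 0` with eigenvalue `e < m` inside a
  subspace `S`, and `m‖w‖² ≤ ⟨w, h w⟩ + P |⟨u, w⟩|²` on `S` (any real `P`), then `m‖v‖² ≤ ⟨v, h v⟩` for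
  every `v ∈ S` orthogonal to `χ` (test the certificate on `v + tχ` with `t` killing `⟨u, ·⟩`;
  this replaces eigenvalue interlacing and needs no spectral theory).

Sources: elementary linear algebra (Gershgorin; rank-one deflation). All statements are [folklore].
-/

set_option linter.dupNamespace false

noncomputable section

namespace Summit.HubbardSuperconductivity.HubbardSuperconductivity.Theorems.CooperPairDMottWalk

open Matrix Finset
open scoped ComplexOrder

/-! ### Transposition of sector arrays -/

section Transpose

variable {p q : ℕ}

/-- `‖xᵀ‖² = ‖x‖²`. [folklore] -/
theorem nsqR_transpose (y : Fin q → Fin p → ℝ) : nsqR (fun i j => y j i) = nsqR y := by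
  unfold nsqR; exact Finset.sum_comm

/-- The double-occupancy form of the transposed array (with the transposed table). [folklore] -/
theorem dblR_transpose (d : Fin p → Fin q → ℕ) (y : Fin q → Fin p → ℝ) :
    dblR d (fun i j => y j i) = dblR (fun j i => d i j) y := by
  unfold dblR; exact Finset.sum_comm

/-- The hopping form of the transposed array (tables swapped). [folklore] -/
theorem hopR_transpose (Ka : Fin p → Fin p → ℤ) (Kb : Fin q → Fin q → ℤ) (y : Fin q → Fin p → ℝ) :
    hopR Ka Kb (fun i j => y j i) = hopR Kb Ka y := by
  unfold hopR
  rw [Finset.sum_comm]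
  exact Finset.sum_congr rfl fun j _ => Finset.sum_congr rfl fun i _ => by ring

/-- **A form bound transfers to the mirrored sector.** [folklore] -/
theorem formBound_transpose {Ka : Fin p → Fin p → ℤ} {Kb : Fin q → Fin q → ℤ} {d : Fin p → Fin q → ℕ}
    {U lam : ℝ} (h : ∀ x : Fin p → Fin q → ℝ, lam * nsqR x ≤ hopR Ka Kb x + U * dblR d x)
    (y : Fin q → Fin p → ℝ) : lam * nsqR y ≤ hopR Kb Ka y + U * dblR (fun j i => d i j) y := by
  have := h (fun i j => y j i)
  rwa [nsqR_transpose, dblR_transpose, hopR_transpose] at this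

end Transpose

/-! ### Chords in `U` -/

section Chord

variable {p q : ℕ} {Ka : Fin p → Fin p → ℤ} {Kb : Fin q → Fin q → ℤ} {d : Fin p → Fin q → ℕ}

/-- **Chord bound on `[2, 4]`**: the sector form is affine in `U`, so lower bounds `lam₂` at `U = 2`
and `lam₄` at `U = 4` give `((4 − U) lam₂ + (U − 2) lam₄)/2` at `U ∈ [2, 4]`. [folklore] -/
theorem formBound_chord24 {lam₂ lam₄ : ℝ}
    (h2 : ∀ x : Fin p → Fin q → ℝ, lam₂ * nsqR x ≤ hopR Ka Kb x + 2 * dblR d x)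
    (h4 : ∀ x : Fin p → Fin q → ℝ, lam₄ * nsqR x ≤ hopR Ka Kb x + 4 * dblR d x)
    {U : ℝ} (hU2 : 2 ≤ U) (hU4 : U ≤ 4) (x : Fin p → Fin q → ℝ) :
    ((4 - U) / 2 * lam₂ + (U - 2) / 2 * lam₄) * nsqR x ≤ hopR Ka Kb x + U * dblR d x := by
  have c2 := mul_le_mul_of_nonneg_left (h2 x) (by linarith : (0 : ℝ) ≤ (4 - U) / 2)
  have c4 := mul_le_mul_of_nonneg_left (h4 x) (by linarith : (0 : ℝ) ≤ (U - 2) / 2)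
  linarith

/-- **Chord bound on a sub-interval `[U₀, U₀ + 1/2]`.** [folklore] -/
theorem formBound_chordHalf {U₀ lam₀ lam₁ : ℝ}
    (h0 : ∀ x : Fin p → Fin q → ℝ, lam₀ * nsqR x ≤ hopR Ka Kb x + U₀ * dblR d x)
    (h1 : ∀ x : Fin p → Fin q → ℝ, lam₁ * nsqR x ≤ hopR Ka Kb x + (U₀ + 1 / 2) * dblR d x)
    {U : ℝ} (hUa : U₀ ≤ U) (hUb : U ≤ U₀ + 1 / 2) (x : Fin p → Fin q → ℝ) :
    (2 * (U₀ + 1 / 2 - U) * lam₀ + 2 * (U - U₀) * lam₁) * nsqR x ≤ hopR Ka Kb x + U * dblR d x := by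
  have c0 := mul_le_mul_of_nonneg_left (h0 x) (by linarith : (0 : ℝ) ≤ 2 * (U₀ + 1 / 2 - U))
  have c1 := mul_le_mul_of_nonneg_left (h1 x) (by linarith : (0 : ℝ) ≤ 2 * (U - U₀))
  nlinarith

end Chord

/-! ### Rank-one deflated Gram certificates -/

section RankOne

variable {p q : ℕ}

/-- `u · x` for an integer array `u` and a real array `x`. [folklore] -/
def dotZR (u : Fin p → Fin q → ℤ) (x : Fin p → Fin q → ℝ) : ℝ := ∑ i, ∑ j, (u i j : ℝ) * x i j

/-- The deflated certificate matrix `bMatP … + P · u uᵀ`. [folklore] -/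
def bMatR (Ka : Fin p → Fin p → ℤ) (Kb : Fin q → Fin q → ℤ) (d : Fin p → Fin q → ℕ) (N Ut m P : ℤ)
    (u : Fin p → Fin q → ℤ) (a b : Fin p × Fin q) : ℤ :=
  bMatP Ka Kb d N Ut m a b + P * (u a.1 a.2 * u b.1 b.2)

/-- The quadratic form of `bMatR` is `N·hopR + Ut·dblR − m·nsqR + P·(u·x)²`. [folklore] -/
theorem bMatR_quadForm (Ka : Fin p → Fin p → ℤ) (Kb : Fin q → Fin q → ℤ) (d : Fin p → Fin q → ℕ)
    (N Ut m P : ℤ) (u : Fin p → Fin q → ℤ) (x : Fin p → Fin q → ℝ) :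
    ∑ a : Fin p × Fin q, ∑ b : Fin p × Fin q, x a.1 a.2 * (bMatR Ka Kb d N Ut m P u a b : ℝ) * x b.1 b.2 =
      N * hopR Ka Kb x + Ut * dblR d x - m * nsqR x + P * dotZR u x ^ 2 := by
  have hsplit : ∀ a b : Fin p × Fin q, x a.1 a.2 * (bMatR Ka Kb d N Ut m P u a b : ℝ) * x b.1 b.2 =
      x a.1 a.2 * (bMatP Ka Kb d N Ut m a b : ℝ) * x b.1 b.2 +
        (P : ℝ) * (((u a.1 a.2 : ℝ) * x a.1 a.2) * ((u b.1 b.2 : ℝ) * x b.1 b.2)) := by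
    intro a b
    simp only [bMatR, Int.cast_add, Int.cast_mul]
    ring
  simp only [hsplit, Finset.sum_add_distrib, bMatP_quadForm, ← Finset.mul_sum]
  have hdot : ∑ a : Fin p × Fin q, (u a.1 a.2 : ℝ) * x a.1 a.2 = dotZR u x := by
    rw [dotZR, Fintype.sum_prod_type]
  rw [← Finset.sum_mul, hdot, sq]

/-- **Certified deflated lower bound of a sector form.** A Gram certificate for
`bMatR Ka Kb d N Ut m P u` gives `m‖x‖² ≤ N·hopR x + Ut·dblR x + P (u·x)²`. [folklore] -/
theorem form_lowerBound_rankOne_of_ddCheckP (Ka : Fin p → Fin p → ℤ) (Kb : Fin q → Fin q → ℤ)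
    (d : Fin p → Fin q → ℕ) (N Ut m P : ℤ) (u : Fin p → Fin q → ℤ)
    (G : Fin p × Fin q → Fin p × Fin q → ℤ) {s : ℤ} (hs : 0 < s)
    (h : ddCheckP (bMatR Ka Kb d N Ut m P u) G s = true) (x : Fin p → Fin q → ℝ) :
    (m : ℝ) * nsqR x ≤ N * hopR Ka Kb x + Ut * dblR d x + P * dotZR u x ^ 2 := by
  have := quadForm_nonneg_of_ddCheckP (bMatR Ka Kb d N Ut m P u) G hs h (fun a => x a.1 a.2)
  simp only [bMatR_quadForm] at this
  linarith

/-- Chord on `[U₀, U₀ + 1/2]` for deflated bounds (the rank-one term is `U`-independent). [folklore] -/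
theorem rankOneBound_chordHalf {Ka : Fin p → Fin p → ℤ} {Kb : Fin q → Fin q → ℤ} {d : Fin p → Fin q → ℕ}
    {u : Fin p → Fin q → ℤ} {U₀ lam₀ lam₁ P : ℝ}
    (h0 : ∀ x : Fin p → Fin q → ℝ, lam₀ * nsqR x ≤ hopR Ka Kb x + U₀ * dblR d x + P * dotZR u x ^ 2)
    (h1 : ∀ x : Fin p → Fin q → ℝ,
      lam₁ * nsqR x ≤ hopR Ka Kb x + (U₀ + 1 / 2) * dblR d x + P * dotZR u x ^ 2)
    {U : ℝ} (hUa : U₀ ≤ U) (hUb : U ≤ U₀ + 1 / 2) (x : Fin p → Fin q → ℝ) :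
    (2 * (U₀ + 1 / 2 - U) * lam₀ + 2 * (U - U₀) * lam₁) * nsqR x ≤
      hopR Ka Kb x + U * dblR d x + P * dotZR u x ^ 2 := by
  have c0 := mul_le_mul_of_nonneg_left (h0 x) (by linarith : (0 : ℝ) ≤ 2 * (U₀ + 1 / 2 - U))
  have c1 := mul_le_mul_of_nonneg_left (h1 x) (by linarith : (0 : ℝ) ≤ 2 * (U - U₀))
  nlinarith

end RankOne

/-! ### Rank-one deflation of a ground eigenvector -/

section Deflation

variable {n : Type*} [Fintype n]

/-- **Deflation bound.** Let `h` be Hermitian, `χ ≠ 0` an eigenvector with real eigenvalue `e` lying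
in a set `S` closed under addition and scalars, and suppose the deflated form bound
`m‖w‖² ≤ Re⟨w, h w⟩ + P |⟨u, w⟩|²` holds on `S` with `e < m` (`P` any real). Then `m‖v‖² ≤ Re⟨v, h v⟩`
for every `v ∈ S` orthogonal to `χ`. Proof: the bound at `χ` forces `⟨u, χ⟩ ≠ 0`; test the bound at
`w = v + tχ` with `t = −⟨u, v⟩/⟨u, χ⟩`, for which `⟨u, w⟩ = 0`, `‖w‖² = ‖v‖² + |t|²‖χ‖²` and
`⟨w, h w⟩ = ⟨v, h v⟩ + |t|² e ‖χ‖²`. [folklore] -/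
theorem deflate_bound {h : Matrix n n ℂ} (hH : h.IsHermitian) {S : Set (n → ℂ)}
    (hSadd : ∀ v w, v ∈ S → w ∈ S → v + w ∈ S) (hSsmul : ∀ (c : ℂ) (v : n → ℂ), v ∈ S → c • v ∈ S)
    {χ u : n → ℂ} (hχS : χ ∈ S) (hχ0 : χ ≠ 0) {e m P : ℝ} (hχe : h *ᵥ χ = (e : ℂ) • χ)
    (hem : e < m)
    (hcert : ∀ w ∈ S, m * (star w ⬝ᵥ w).re ≤ (star w ⬝ᵥ (h *ᵥ w)).re + P * ‖star u ⬝ᵥ w‖ ^ 2)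
    {v : n → ℂ} (hvS : v ∈ S) (hv : star χ ⬝ᵥ v = 0) :
    m * (star v ⬝ᵥ v).re ≤ (star v ⬝ᵥ (h *ᵥ v)).re := by
  have hχpos : 0 < (star χ ⬝ᵥ χ).re := (Complex.pos_iff.mp (dotProduct_star_self_pos_iff.2 hχ0)).1
  have hχform : star χ ⬝ᵥ (h *ᵥ χ) = (e : ℂ) * (star χ ⬝ᵥ χ) := by
    rw [hχe, dotProduct_smul, smul_eq_mul]
  have hχform_re : (star χ ⬝ᵥ (h *ᵥ χ)).re = e * (star χ ⬝ᵥ χ).re := by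
    rw [hχform, Complex.re_ofReal_mul]
  -- `α = ⟨u, χ⟩ ≠ 0`
  have hα0 : star u ⬝ᵥ χ ≠ 0 := by
    intro h0
    have hc := hcert χ hχS
    rw [h0, norm_zero, hχform_re] at hc
    have : m * (star χ ⬝ᵥ χ).re ≤ e * (star χ ⬝ᵥ χ).re := by simpa using hc
    nlinarith
  -- the test vector
  set α : ℂ := star u ⬝ᵥ χ with hαdef
  set β : ℂ := star u ⬝ᵥ v with hβdef
  set t : ℂ := -β / α with htdef
  set w : n → ℂ := v + t • χ with hwdef
  have hwS : w ∈ S := hSadd _ _ hvS (hSsmul _ _ hχS)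
  -- cross terms vanish
  have hvχ : star v ⬝ᵥ χ = 0 := by rw [star_dotProduct, hv, star_zero]
  have hχhv : star χ ⬝ᵥ (h *ᵥ v) = 0 := by
    calc star χ ⬝ᵥ (h *ᵥ v) = star (h *ᵥ χ) ⬝ᵥ v := by rw [star_mulVec, hH.eq, dotProduct_mulVec]
      _ = 0 := by rw [hχe, star_smul, smul_dotProduct, hv, smul_zero]
  have hvhχ : star v ⬝ᵥ (h *ᵥ χ) = 0 := by rw [hχe, dotProduct_smul, hvχ, smul_zero]
  -- expansions
  have hww : star w ⬝ᵥ w = star v ⬝ᵥ v + star t * t * (star χ ⬝ᵥ χ) := by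
    simp only [hwdef, star_add, star_smul, add_dotProduct, dotProduct_add, smul_dotProduct,
      dotProduct_smul, hv, hvχ, smul_eq_mul, mul_zero, add_zero, zero_add]
    ring
  have hwhw : star w ⬝ᵥ (h *ᵥ w) = star v ⬝ᵥ (h *ᵥ v) + star t * t * (star χ ⬝ᵥ (h *ᵥ χ)) := by
    simp only [hwdef, mulVec_add, mulVec_smul, star_add, star_smul, add_dotProduct, dotProduct_add,
      smul_dotProduct, dotProduct_smul, hχhv, hvhχ, smul_eq_mul, mul_zero, add_zero, zero_add]
    ring
  have huw : star u ⬝ᵥ w = 0 := by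
    simp only [hwdef, dotProduct_add, dotProduct_smul, smul_eq_mul]
    rw [← hαdef, ← hβdef, htdef]
    field_simp
    ring
  have htt : star t * t = ((‖t‖ ^ 2 : ℝ) : ℂ) := by
    rw [Complex.star_def, mul_comm, Complex.mul_conj, Complex.sq_norm]
  have hc := hcert w hwS
  rw [huw, norm_zero, hww, hwhw, htt, hχform] at hc
  simp only [ne_eq, OfNat.ofNat_ne_zero, not_false_eq_true, zero_pow, mul_zero, add_zero,
    Complex.add_re, Complex.re_ofReal_mul] at hc
  have ht0 : 0 ≤ ‖t‖ ^ 2 := sq_nonneg _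
  nlinarith [mul_nonneg ht0 hχpos.le]

end Deflation

/-! ### Registered sub-goal of the crux item (stmt-HubbardSuperconductivity-1177) -/

set_option linter.style.longLine false in
/-- Registered sub-goal `plaquetteGCWindow_deflateBound` of the crux item: the rank-one deflation bound
(`deflate_bound`, monomorphic restatement). [folklore] -/
theorem plaquetteGCWindow_deflateBound : ∀ {n : Type} [Fintype n] {h : Matrix n n ℂ}, h.IsHermitian → ∀ {S : Set (n → ℂ)}, (∀ v w, v ∈ S → w ∈ S → v + w ∈ S) → (∀ (c : ℂ) (v : n → ℂ), v ∈ S → c • v ∈ S) → ∀ {χ u : n → ℂ}, χ ∈ S → χ ≠ 0 → ∀ {e m P : ℝ}, h *ᵥ χ = (e : ℂ) • χ → e < m → (∀ w ∈ S, m * (star w ⬝ᵥ w).re ≤ (star w ⬝ᵥ (h *ᵥ w)).re + P * ‖star u ⬝ᵥ w‖ ^ 2) → ∀ {v : n → ℂ}, v ∈ S → star χ ⬝ᵥ v = 0 → m * (star v ⬝ᵥ v).re ≤ (star v ⬝ᵥ (h *ᵥ v)).re :=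
  deflate_bound

end Summit.HubbardSuperconductivity.HubbardSuperconductivity.Theorems.CooperPairDMottWalk

end
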